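import Literature.Probability.FitznerVanDerHofstad2017.NobleBlocks

/-!
# [FvdH17] §6.1, the summation step (6.5) of the proof of Lemma 5.2 / Lemma 5.3, instantiated on the
`Letters`-blocks of `NobleBlocks`: `Σ_x Ξ(x) ≤ P⃗^S Ā^ι P⃗^E` from the `x`-space bound (6.4)

Source: R. Fitzner, R. van der Hofstad, *Mean-field behavior for nearest-neighbor percolation in `d > 10`*,
Electron. J. Probab. **22** (2017) no. 43 [FvdH17], §6.1, displays (6.4)–(6.5) (arXiv:1506.07977v2 p. 58; TeX labels
`lemmapercboundXi1-1-step0`, `lemmapercboundXi1-1-summation`):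

"`Ξ^{(1)}_p(x) ≤ Σ_{a,b=0}^{2} Σ_{u,ι,w,z,t} P^{S,a}(u,w) Ā^{ι,a,b}(u,w,t,z) P^{E,b}(t−x,z−x)`, (6.4) … Once this is
established, the bound (5.x) follows as
`Σ_x Ξ^{(1)}_p(x) ≤ Σ_{a,b} Σ_{x,u,ι,w,z,t} P^{S,a}(u,w) Ā^{ι,a,b}(u,w,t,z) P^{E,b}(t−x,z−x)
 = Σ_{a,b} Σ_{u,w} P^{S,a}(u,u+w) Σ_{y,x} P^{E,b}(x,x+y) Σ_{ι,t} Ā^{ι,a,b}(0,w,t,t+y)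
 ≤ … sup_{w,y} Σ_{ι,t} Ā^{ι,a,b}(0,w,t,t+y) = Σ_{a,b} (P⃗^S)_a (Ā^ι)_{a,b} (P⃗^E)_b = P⃗^S Ā^ι P⃗^E`. (6.5)"

The abstract summation is lean-proved in `BlockSummation` (`tsum_le_of_xSpaceBound'`, `junction_le`: translation
invariance + Tonelli + `Σ ≤ sup Σ`, in `[0,∞]`, no convergence hypothesis).  This module is its INSTANCE on the blocks
of `NobleBlocks` over an arbitrary letter table `L : Letters d`: for any function `Ξ : ℤ^d → [0,∞]` obeying the
`x`-space bound (6.4) with left pieces `PL^a` (for Lemma 5.2: `PL = blockPS L`, i.e. `P^{S,a}`; for Lemma 5.3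
(5.x) = `BoundXiIotaOne-1`: the initial pieces `P^{ι,a}` of `Ξ^{(1),ι}`, `blockPiota L ι`), the double-open
blocks `Ā^{ι,a,b} = blockAbar L ι a b` and the right pieces `P^{E,b} = blockPE L b`,
`Σ_x Ξ(x) ≤ P⃗L ᵛ* Ā^ι ⬝ P⃗^E` with `P⃗L = vecP PL`, `Ā^ι = matAbarIota L`, `P⃗^E = vecPE L`
(`tsum_le_vecP_vecMul_matAbarIota_dotProduct_vecPE`), and the two printed specialisations
`tsum_le_vecPS_matAbarIota_vecPE` ((6.5): `Σ_x Ξ ≤ P⃗^S Ā^ι P⃗^E`) and `tsum_le_vecPiota_matAbarIota_vecPE`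
(`Σ_x Ξ ≤ P⃗^{ι} Ā^ι P⃗^E` with `P⃗^{ι} = vecP (blockPiota L ι)`).

This fixes the CURRENCY of the pointwise bound (6.4) that the case analysis of §6.1 (left triangle → `P^{S,a}`, right
triangle → `P^{E,b}`, middle square → `Ā^{ι,a,b}`, nine cases `(a,b)`) has to deliver: the hypothesis `hΞ` below,
with the summation order `Σ'_u Σ'_w Σ'_t Σ'_z Σ_ι Σ_a Σ_b`.  Nothing here is specific to percolation or to any
dimension; nothing here is a cited hypothesis — every statement is proved.  The pointwise bound (6.4) itself for the
percolation letters is NOT asserted here.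
-/

noncomputable section

namespace Literature.Probability.FitznerVanDerHofstad2017.NobleBlocks

open Literature.Probability.LatticeModels Literature.Probability.Percolation
open Literature.Probability.FitznerVanDerHofstad2017.BlockSummation
open scoped BigOperators ENNReal Matrix

variable {d : ℕ}

/-- **(6.5), abstract left piece.**  If `Ξ(x) ≤ Σ_{u,w,t,z} Σ_ι Σ_{a,b} PL^a(u,w) Ā^{ι,a,b}(u,w,t,z) P^{E,b}(t−x,z−x)`
for every `x` (the shape (6.4)), then `Σ_x Ξ(x) ≤ P⃗L ᵛ* Ā^ι ⬝ P⃗^E`.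
[cite: FitznerVanDerHofstad2017, §6.1 (6.4)–(6.5) (arXiv:1506.07977v2 p. 58)] -/
theorem tsum_le_vecP_vecMul_matAbarIota_dotProduct_vecPE (L : Letters d) (PL : Fin 3 → Site d → Site d → ℝ≥0∞)
    (Ξ : Site d → ℝ≥0∞)
    (hΞ : ∀ x, Ξ x ≤ ∑' u, ∑' w, ∑' t, ∑' z, ∑ ι : Fin d × Bool, ∑ a : Fin 3, ∑ b : Fin 3,
      PL a u w * blockAbar L ι a b u w t z * blockPE L b (t - x) (z - x)) :
    ∑' x, Ξ x ≤ vecP PL ᵥ* matAbarIota L ⬝ᵥ vecPE L := by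
  rw [← sum_sum_mul_mul_eq_vecMul_dotProduct]
  exact tsum_le_of_xSpaceBound' (fun ι a b => isTransInv_blockAbar L ι a b) Ξ PL (blockPE L) hΞ

/-- **(6.5) = [FvdH17] (5.x) `Σ_x Ξ^{(1)}_p(x) ≤ P⃗^S Ā^ι P⃗^E`, summation half**: the `x`-space bound (6.4) with
`P^{S,a}`, `Ā^{ι,a,b}`, `P^{E,b}` implies `Σ_x Ξ(x) ≤ P⃗^S ᵛ* Ā^ι ⬝ P⃗^E`.
[cite: FitznerVanDerHofstad2017, Lemma 5.2 first display and §6.1 (6.4)–(6.5) (arXiv:1506.07977v2 pp. 50, 58)] -/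
theorem tsum_le_vecPS_matAbarIota_vecPE (L : Letters d) (Ξ : Site d → ℝ≥0∞)
    (hΞ : ∀ x, Ξ x ≤ ∑' u, ∑' w, ∑' t, ∑' z, ∑ ι : Fin d × Bool, ∑ a : Fin 3, ∑ b : Fin 3,
      blockPS L a u w * blockAbar L ι a b u w t z * blockPE L b (t - x) (z - x)) :
    ∑' x, Ξ x ≤ vecPS L ᵥ* matAbarIota L ⬝ᵥ vecPE L :=
  tsum_le_vecP_vecMul_matAbarIota_dotProduct_vecPE L (blockPS L) Ξ hΞ

/-- **[FvdH17] Lemma 5.3 first display `Σ_x Ξ^{(1),ι}_p(x) ≤ P⃗^ι Ā^ι P⃗^E`, summation half**: the `x`-space bound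
of shape (6.4) with the initial pieces `P^{ι,a}` of the fixed direction `ι` in place of `P^{S,a}` implies
`Σ_x Ξ(x) ≤ P⃗^{ι} ᵛ* Ā^ι ⬝ P⃗^E`, `P⃗^{ι} = vecP (blockPiota L ι)` ("The proof for `Ξ^ι` differs only in the
different initial block of the bounding diagram").
[cite: FitznerVanDerHofstad2017, Lemma 5.3 first display (arXiv:1506.07977v2 p. 50); §6.1 (6.5) (p. 58)] -/
theorem tsum_le_vecPiota_matAbarIota_vecPE (L : Letters d) (ι₀ : Fin d × Bool) (Ξ : Site d → ℝ≥0∞)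
    (hΞ : ∀ x, Ξ x ≤ ∑' u, ∑' w, ∑' t, ∑' z, ∑ ι : Fin d × Bool, ∑ a : Fin 3, ∑ b : Fin 3,
      blockPiota L ι₀ a u w * blockAbar L ι a b u w t z * blockPE L b (t - x) (z - x)) :
    ∑' x, Ξ x ≤ vecP (blockPiota L ι₀) ᵥ* matAbarIota L ⬝ᵥ vecPE L :=
  tsum_le_vecP_vecMul_matAbarIota_dotProduct_vecPE L (blockPiota L ι₀) Ξ hΞ

end Literature.Probability.FitznerVanDerHofstad2017.NobleBlocks

end
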